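import Summits.AnomalousDissipation.AnomalousDissipation.Theorems.SolenoidalFractalHomogenisationLagrangianStepVmodSSRegimesD
import Summits.AnomalousDissipation.AnomalousDissipation.Theorems.SolenoidalFractalHomogenisationLagrangianStepVmodPairSplit
import HarnessLib

/-!
# K1L_D (stmt-AnomalousDissipation-27980): (V_mod) flat stage, block (sf) — COARSE LABELS, part 1: the SIDEBAND of a pair datum at grid phase
# (raw L-sb), the pairing-to-sideband step, the MID row (`P < τ`, `Rτ ≤ 2`) and the ν-FLOOR row in the allowance currency of `SFMode_textEVH`
(helper; `--supports 27980 --as helper`; prover ad-k3l-bookkeeping-p1 g10, (sf) owner by RULING D28-5; the (sf) twins of p1 g15's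
`…VmodSSRegimesC` («scale_mid») and p3 g10's `…VmodFsMidRow`, with the SIDEBAND `√(‖Uw‖² − ‖𝓕(Uw)(ℓ)‖² − ‖𝓕(Uw)(−ℓ)‖²)` of a slow pair
datum `w` in place of the defect / the leak.)

Notation (parts A–D of p1): `R = 8π²·loT·|ℓ|²`, `P = M·W.period/ν`, `u = RP`, `τ = t − s`, `y = P/τ`, `D₀ = 8π²(lo/Λ)·M·Wp·c`,
`cS = 8(√|ℓ|²/n)·Σ‖slotAmp W‖/(π·ν·lo/Λ)` (p1's one-step sideband constant) and `cSp := 8·Σ‖slotAmp W‖/(π(lo/Λ)√D₀)` so that `cS ≤ cSp·√u`.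
* `abs_inner_le_sideband_mul_norm` — for a fast test `ζ` and any `z ∈ divFreeL2`: `|⟪z, ζ⟫| ≤ sideband(z)·‖ζ‖` (the pair part of `z` is `⊥ ζ`);
* `sideband_le_cS` — RAW L-sb: grid start `s = j₀P`, pair datum `w`, EVERY `t ≥ s`: `sideband(U s t w) ≤ cS·‖w‖` (`VmodGen.sqrt_fast_le` with
  `fast(w) = 0`);
* `cS_le_cSp_sqrt` — `cS ≤ cSp·√u`;
* **`sideband_le_alw_of_scale_mid`** — MID row: `P < τ`, `Rτ ≤ 2` (hence `u ≤ 2`), `e ≤ 1/2`, `C₁ ≥ 2cSp` ⇒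
  `sideband(U s t w) ≤ (C₁(C₁(ν^e + (⌈K/ν⌉/n)^e) + (min 1 (P/τ))^e))·√(dW lo Λ c ν n τ ℓ)·‖w‖`;
* **`sideband_le_alw_of_nufloor`** — ν-FLOOR row (no smallness; `ν_c ≤ ν`, `P < τ`, `u ≤ 1`, `0 ≤ e ≤ 1/2`, `C₁² ν_c^e ≥ 2cSp`): same conclusion.
General phase is NOT covered here (finding F-k3l10-1: it needs the bridge along a phase-shifted carrier).  `sorry`-free; NOT a proof of (sf), of
the stub, of K1L_D or of AD; rung F-D1.A0.
-/

set_option linter.dupNamespace false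

noncomputable section

namespace Summit.AnomalousDissipation.AnomalousDissipation.Theorems.SolenoidalFractalHomogenisation.LagrangianStep.VmodGen

open Set MeasureTheory Complex UnitAddTorus
open scoped InnerProductSpace ENNReal
open Literature.Analysis Literature.Analysis.FunctionSpaces Literature.Analysis.FunctionSpaces.Torus
open Literature.Analysis.FluidPDE Literature.Analysis.FluidPDE.Torus Literature.Analysis.FluidPDE.LatticeShear
open Summit.AnomalousDissipation.AnomalousDissipation.Theorems.SolenoidalFractalHomogenisation.LagrangianStep.Sideband (slotAmp)
open Summit.AnomalousDissipation.AnomalousDissipation.Theorems.SolenoidalFractalHomogenisation.LagrangianStep.VmodFlat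
  (fc fc_sub loT dW IsFast inner_eq_zero_of_fc_disjoint)
open Summit.AnomalousDissipation.AnomalousDissipation.Theorems.SolenoidalFractalHomogenisation.RealisedQuasiStaticCellLaw
  (isSmooth_cell isDivFree_cell memLp_top_stLift_cell)

/-! ## §1 Pairing with a fast test sees only the sideband -/

/-- **`|⟪z, ζ⟫| ≤ sideband(z)·‖ζ‖`** for `z ∈ divFreeL2`, a fast test `ζ` and a nonzero slow label `ℓ ∈ freqBall (n/4)`: the pair part of `z` at
`±ℓ` is orthogonal to `ζ`. [folklore] -/
theorem abs_inner_le_sideband_mul_norm {n : ℕ} {ℓ : Fin 3 → ℤ} (hℓ0 : ℓ ≠ 0) (hℓ : ℓ ∈ Torus.freqBall (d := Fin 3) (n / 4))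
    (z : V2) (hz : z ∈ divFreeL2 (Fin 3)) (ζ : V2) (hζ : IsFast n ζ) :
    |⟪z, ζ⟫_ℝ| ≤ Real.sqrt (‖z‖ ^ 2 - (‖fc z ℓ‖ ^ 2 + ‖fc z (-ℓ)‖ ^ 2)) * ‖ζ‖ := by
  obtain ⟨a, f, hzaf, -, -, haoff, -, -, -, -, -, -, hnf⟩ := exists_pair_split hℓ0 z hz
  have hℓ' : -ℓ ∈ Torus.freqBall (d := Fin 3) (n / 4) := (Torus.neg_mem_freqBall).2 hℓ
  have ha : ⟪a, ζ⟫_ℝ = 0 := inner_eq_zero_of_fc_disjoint fun k' => by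
    by_cases h1 : k' = ℓ
    · exact Or.inr (by rw [h1]; exact hζ ℓ hℓ)
    · by_cases h2 : k' = -ℓ
      · exact Or.inr (by rw [h2]; exact hζ (-ℓ) hℓ')
      · exact Or.inl (haoff k' h1 h2)
  have hf : ‖f‖ = Real.sqrt (‖z‖ ^ 2 - (‖fc z ℓ‖ ^ 2 + ‖fc z (-ℓ)‖ ^ 2)) := by rw [← hnf, Real.sqrt_sq (norm_nonneg _)]
  rw [← hf, hzaf, inner_add_left, ha, zero_add]
  exact abs_real_inner_le_norm f ζ

/-! ## §2 The raw sideband bound at grid phase -/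

section Clause

variable {k : ℕ} {W : LatticeWord k} {M : ℝ} {hM : 0 < M} {c : ℝ}
  {lo hi Λ β K : ℝ} {ν ν₀ : ℝ} {n : ℕ} {𝔸 : Visc4 (Fin 3)} {Tw : ℝ} {U : ℝ → ℝ → (V2 →L[ℝ] V2)}

set_option maxHeartbeats 1600000 in
/-- **RAW L-sb FOR A PAIR DATUM AT GRID PHASE**: grid start `s = j₀·P`, every `t ∈ [s, Tw]`, pair datum `w` at a nonzero slow label `ℓ ∈ freqBall Lb`,
`2Lb < n`:  `sideband(U s t w) ≤ cS·‖w‖`, `cS = 8(√|ℓ|²/n)·Σ‖slotAmp W‖/(π·(ν·lo/Λ))`. -/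
theorem sideband_le_cS (hlo : 0 < lo) (hhi : 0 ≤ hi) (hΛ : 1 ≤ Λ)
    (hν : ν ∈ Set.Ioo 0 ν₀) (hn : 1 ≤ n) (hwin : ∃ lam ∈ Set.Icc (1:ℝ) Λ, NearIso 𝔸 (ν * (lo / lam)) (ν * (hi * lam)))
    (hU : IsPropagator Tw (cellField W M hM ν hν.1 n) ((1 / (n:ℝ) ^ 2) • 𝔸) U)
    {s t : ℝ} (j₀ : ℕ) (hs₀ : s = j₀ * (M * W.period / ν)) (hst : s ≤ t) (htT : t ≤ Tw) (hsT : s < Tw)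
    {Lb : ℕ} (hLb : 2 * Lb < n) {ℓ : Fin 3 → ℤ} (hℓ0 : ℓ ≠ 0) (hℓL : ℓ ∈ Torus.freqBall (d := Fin 3) Lb)
    (w : V2) (hw : w ∈ divFreeL2 (Fin 3)) (hws : ∀ k', k' ≠ ℓ → k' ≠ -ℓ → fc w k' = 0) :
    Real.sqrt (‖U s t w‖ ^ 2 - (‖fc (U s t w) ℓ‖ ^ 2 + ‖fc (U s t w) (-ℓ)‖ ^ 2))
      ≤ (8 * (Real.sqrt (freqNormSq ℓ) / n) * (∑ j, ‖slotAmp W j‖) / (Real.pi * (ν * (lo / Λ)))) * ‖w‖ := by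
  classical
  have hnpos : 0 < n := hn
  have hn1 : n ≠ 0 := Nat.pos_iff_ne_zero.1 hnpos
  have hWp := PermissibleCarrier.period_pos W
  have hP0 : 0 < M * W.period / ν := div_pos (mul_pos hM hWp) hν.1
  have hs0 : 0 ≤ s := by rw [hs₀]; positivity
  have hΛ0 : 0 < Λ := lt_of_lt_of_le one_pos hΛ
  have hloA : 0 < ν * (lo / Λ) := mul_pos hν.1 (div_pos hlo hΛ0)
  have hAΛ : NearIso 𝔸 (ν * (lo / Λ)) (ν * (hi * Λ)) := by
    obtain ⟨lam, hlam, hA⟩ := hwin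
    have hlam1 : 0 < lam := lt_of_lt_of_le one_pos hlam.1
    exact hA.mono (mul_le_mul_of_nonneg_left (div_le_div_of_nonneg_left hlo.le hlam1 hlam.2) hν.1.le)
      (mul_le_mul_of_nonneg_left (mul_le_mul_of_nonneg_left hlam.2 hhi) hν.1.le)
  -- `2√q < n`
  have hℓn : 2 * Real.sqrt (freqNormSq ℓ) < n := by
    have h2 := hℓL
    rw [Torus.mem_freqBall] at h2
    have hsq : Real.sqrt (freqNormSq ℓ) ≤ Lb := by
      rw [← Real.sqrt_sq (Nat.cast_nonneg Lb)]; exact Real.sqrt_le_sqrt h2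
    have : (2:ℝ) * Lb < n := by exact_mod_cast hLb
    linarith
  -- the stretched word and the grid phase
  set W₁ : LatticeWord k := (W.stretch M hM).stretch (1 / ν) (one_div_pos.mpr hν.1) with hW₁
  have hU' : IsPropagator Tw (W₁.cell n) ((1 / (n:ℝ) ^ 2) • 𝔸) U := hU
  have hphase : ∀ τ, W₁.cell n (s + τ) = W₁.cell n τ := by
    intro τ; rw [hs₀]; exact cellField_add_nat_mul_period W M hM ν hν.1 n j₀ τ
  -- the pair datum is carried by the class pair and has no fast content
  have hwcl : ∀ k', fc w k' ≠ 0 → (∀ i, (n : ℤ) ∣ k' i - ℓ i) ∨ (∀ i, (n : ℤ) ∣ k' i + ℓ i) := by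
    intro k' hk'
    by_cases h1 : k' = ℓ
    · left; intro i; rw [h1, sub_self]; exact dvd_zero _
    · by_cases h2 : k' = -ℓ
      · right; intro i; rw [h2, Pi.neg_apply, neg_add_cancel]; exact dvd_zero _
      · exact absurd (hws k' h1 h2) hk'
  have hfast0 : ‖w‖ ^ 2 - (‖fc w ℓ‖ ^ 2 + ‖fc w (-ℓ)‖ ^ 2) = 0 := by
    have hne : ℓ ≠ -ℓ := fun h' => hℓ0 (by
      funext i; have hi := congrFun h' i; simp only [Pi.neg_apply] at hi; have : ℓ i = 0 := by omega
      simpa using this)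
    have hpars := hasSum_norm_sq_fcoeff w
    have hfin : HasSum (fun k' => ‖fc w k'‖ ^ 2) (∑ k' ∈ ({ℓ, -ℓ} : Finset (Fin 3 → ℤ)), ‖fc w k'‖ ^ 2) := by
      refine hasSum_sum_of_ne_finset_zero fun k' hk' => ?_
      rw [Finset.mem_insert, Finset.mem_singleton, not_or] at hk'
      rw [hws k' hk'.1 hk'.2, norm_zero, zero_pow two_ne_zero]
    have e := hpars.unique hfin
    rw [Finset.sum_pair hne] at e
    rw [e]; ring
  have key := sqrt_fast_le W₁ hn1 hAΛ hloA hU' hs0 hst htT hsT hphase hℓ0 hℓn w ((mem_divFreeL2_iff w).1 hw) hwcl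
  rw [hfast0, Real.sqrt_zero, mul_zero, add_zero] at key
  have hα : (∑ j, ‖slotAmp W₁ j‖) = ∑ j, ‖slotAmp W j‖ := Finset.sum_congr rfl fun j _ => rfl
  rw [hα] at key
  exact key

/-! ## §3 Scalar tools of the mid and floor rows -/

/-- The mid-window charge: for `0 < u ≤ Y ≤ 2` and `e ≤ 1/2`, `√u ≤ 2·(u/Y)^e·√(½·min 1 Y)`. [folklore] -/
theorem sqrt_le_two_mul_rpow_mul_sqrt {u Y e : ℝ} (hu : 0 < u) (huY : u ≤ Y) (hY2 : Y ≤ 2) (he : e ≤ 1 / 2) :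
    Real.sqrt u ≤ 2 * (u / Y) ^ e * Real.sqrt (1 / 2 * min 1 Y) := by
  have hY : 0 < Y := lt_of_lt_of_le hu huY
  have hx1 : u / Y ≤ 1 := (div_le_one hY).2 huY
  have hx0 : 0 < u / Y := div_pos hu hY
  have h1 : Real.sqrt (u / Y) ≤ (u / Y) ^ e := by
    rw [Real.sqrt_eq_rpow]; exact Real.rpow_le_rpow_of_exponent_ge hx0 hx1 he
  have hm : u / 4 ≤ (u / Y) * (1 / 2 * min 1 Y) := by
    by_cases hY1 : Y ≤ 1
    · rw [min_eq_right hY1]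
      have e : (u / Y) * (1 / 2 * Y) = u / 2 := by field_simp
      rw [e]; linarith
    · rw [not_le] at hY1; rw [min_eq_left hY1.le]
      have : u / Y ≥ u / 2 := div_le_div_of_nonneg_left hu.le hY hY2
      nlinarith
  have h2 : Real.sqrt u ≤ 2 * (Real.sqrt (u / Y) * Real.sqrt (1 / 2 * min 1 Y)) := by
    rw [← Real.sqrt_mul hx0.le]
    have h3 : Real.sqrt u ≤ Real.sqrt (4 * ((u / Y) * (1 / 2 * min 1 Y))) := Real.sqrt_le_sqrt (by linarith)
    rw [Real.sqrt_mul (by norm_num), show Real.sqrt 4 = 2 by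
      rw [show (4:ℝ) = 2 ^ 2 by norm_num, Real.sqrt_sq (by norm_num)]] at h3
    exact h3
  calc Real.sqrt u ≤ 2 * (Real.sqrt (u / Y) * Real.sqrt (1 / 2 * min 1 Y)) := h2
    _ ≤ 2 * ((u / Y) ^ e * Real.sqrt (1 / 2 * min 1 Y)) := by gcongr
    _ = _ := by ring

/-- **`cS ≤ cSp·√u`**: the one-step sideband constant against the scale `u = RP` (same step as p1's `cL ≤ cLp√u`). -/
theorem cS_le_cSp_sqrt (hlo : 0 < lo) (hΛ : 1 ≤ Λ) (hc : 0 < c) (hM' : 0 < M) (hν0 : 0 < ν) (hn : 1 ≤ n) (S : ℝ) (hS : 0 ≤ S)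
    (ℓ : Fin 3 → ℤ) :
    8 * (Real.sqrt (freqNormSq ℓ) / n) * S / (Real.pi * (ν * (lo / Λ)))
      ≤ (8 * S / (Real.pi * (lo / Λ) * Real.sqrt (8 * Real.pi ^ 2 * (lo / Λ) * (M * W.period) * c)))
          * Real.sqrt (8 * Real.pi ^ 2 * loT lo Λ c ν n * freqNormSq ℓ * (M * W.period / ν)) := by
  have hn0 : (0:ℝ) < n := by exact_mod_cast (show 0 < n from hn)
  have hΛ0 : 0 < Λ := lt_of_lt_of_le one_pos hΛ
  have hloΛ : 0 < lo / Λ := div_pos hlo hΛ0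
  have hWp := PermissibleCarrier.period_pos W
  have hMW : 0 < M * W.period := mul_pos hM' hWp
  set q : ℝ := freqNormSq ℓ with hq
  have hq0 : 0 ≤ q := freqNormSq_nonneg ℓ
  set D₀ : ℝ := 8 * Real.pi ^ 2 * (lo / Λ) * (M * W.period) * c with hD₀
  have hD₀0 : 0 < D₀ := by rw [hD₀]; positivity
  set u : ℝ := 8 * Real.pi ^ 2 * loT lo Λ c ν n * q * (M * W.period / ν) with hu
  have hsq : q / ((n:ℝ) ^ 2 * ν ^ 2) ≤ u / D₀ := by
    rw [le_div_iff₀ hD₀0]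
    have h := RP_ge (c := c) hloΛ.le hMW.le hν0 hn ℓ
    calc q / ((n:ℝ) ^ 2 * ν ^ 2) * D₀ = 8 * Real.pi ^ 2 * (lo / Λ) * (M * W.period) * c * (q / ((n:ℝ) ^ 2 * ν ^ 2)) := by
          rw [hD₀]; ring
      _ ≤ u := h
  have hu0 : 0 ≤ u := le_trans (by positivity) ((le_div_iff₀ hD₀0).1 hsq) |> fun h => by nlinarith [hD₀0]
  have hsq2 : Real.sqrt q / (n * ν) ≤ Real.sqrt u / Real.sqrt D₀ := by
    have hnν : 0 < (n:ℝ) * ν := mul_pos hn0 hν0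
    have eL : Real.sqrt q / (n * ν) = Real.sqrt (q / ((n:ℝ) * ν) ^ 2) := by
      rw [Real.sqrt_div hq0, Real.sqrt_sq hnν.le]
    have eR : Real.sqrt u / Real.sqrt D₀ = Real.sqrt (u / D₀) := by rw [Real.sqrt_div hu0]
    rw [eL, eR]
    refine Real.sqrt_le_sqrt ?_
    rw [show ((n:ℝ) * ν) ^ 2 = (n:ℝ) ^ 2 * ν ^ 2 by ring]
    exact hsq
  have e1 : 8 * (Real.sqrt q / n) * S / (Real.pi * (ν * (lo / Λ))) = (8 * S / (Real.pi * (lo / Λ))) * (Real.sqrt q / (n * ν)) := by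
    field_simp
  have e2 : (8 * S / (Real.pi * (lo / Λ) * Real.sqrt D₀)) * Real.sqrt u = (8 * S / (Real.pi * (lo / Λ))) * (Real.sqrt u / Real.sqrt D₀) := by
    field_simp
  rw [e1, e2]
  exact mul_le_mul_of_nonneg_left hsq2 (by positivity)

/-! ## §4 The mid row and the ν-floor row -/

set_option maxHeartbeats 1600000 in
/-- **THE MID ROW OF (sf) ON COARSE LABELS** (grid phase `s = j₀P`, `P < τ`, `Rτ ≤ 2`, `e ≤ 1/2`, `C₁ ≥ 2cSp`):
`sideband(U s t w) ≤ (C₁(C₁(ν^e + (⌈K/ν⌉/n)^e) + (min 1 (P/τ))^e))·√(dW lo Λ c ν n τ ℓ)·‖w‖`. -/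
theorem sideband_le_alw_of_scale_mid (hlo : 0 < lo) (hhi : 0 ≤ hi) (hΛ : 1 ≤ Λ) (hc : 0 < c)
    (hν : ν ∈ Set.Ioo 0 ν₀) (hn : 1 ≤ n) (hwin : ∃ lam ∈ Set.Icc (1:ℝ) Λ, NearIso 𝔸 (ν * (lo / lam)) (ν * (hi * lam)))
    (hU : IsPropagator Tw (cellField W M hM ν hν.1 n) ((1 / (n:ℝ) ^ 2) • 𝔸) U)
    {s t : ℝ} (j₀ : ℕ) (hs₀ : s = j₀ * (M * W.period / ν)) (htT : t ≤ Tw)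
    {Lb : ℕ} (hLb : 2 * Lb < n) {ℓ : Fin 3 → ℤ} (hℓ0 : ℓ ≠ 0) (hℓL : ℓ ∈ Torus.freqBall (d := Fin 3) Lb)
    (w : V2) (hw : w ∈ divFreeL2 (Fin 3)) (hws : ∀ k', k' ≠ ℓ → k' ≠ -ℓ → fc w k' = 0)
    {C₁ e : ℝ} (hC₁0 : 0 ≤ C₁)
    (hC₁ : 2 * (8 * (∑ j, ‖slotAmp W j‖) / (Real.pi * (lo / Λ) * Real.sqrt (8 * Real.pi ^ 2 * (lo / Λ) * (M * W.period) * c))) ≤ C₁)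
    (he12 : e ≤ 1 / 2)
    (hPτ : M * W.period / ν < t - s)
    (hRτ : 8 * Real.pi ^ 2 * loT lo Λ c ν n * Torus.freqNormSq ℓ * (t - s) ≤ 2) :
    Real.sqrt (‖U s t w‖ ^ 2 - (‖fc (U s t w) ℓ‖ ^ 2 + ‖fc (U s t w) (-ℓ)‖ ^ 2))
      ≤ (C₁ * (C₁ * (ν ^ e + ((⌈K / ν⌉₊ : ℝ) / n) ^ e) + (min 1 ((M * W.period / ν) / (t - s))) ^ e))
        * Real.sqrt (dW lo Λ c ν n (t - s) ℓ) * ‖w‖ := by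
  have hWp := PermissibleCarrier.period_pos W
  have hMW : 0 < M * W.period := mul_pos hM hWp
  have hn0 : (0:ℝ) < n := by exact_mod_cast (show 0 < n from hn)
  have hΛ0 : 0 < Λ := lt_of_lt_of_le one_pos hΛ
  have hloΛ : 0 < lo / Λ := div_pos hlo hΛ0
  set P : ℝ := M * W.period / ν with hP
  have hP0 : 0 < P := div_pos hMW hν.1
  have hst : s < t := by linarith
  have hτ0 : 0 < t - s := by linarith
  have hsT : s < Tw := lt_of_lt_of_le hst htT
  set q : ℝ := Torus.freqNormSq ℓ with hq
  set R : ℝ := 8 * Real.pi ^ 2 * loT lo Λ c ν n * q with hR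
  set u : ℝ := R * P with hu
  set Y : ℝ := R * (t - s) with hY
  have hloT : 0 < loT lo Λ c ν n := by
    unfold loT; have hνc : 0 < ν + c / ν := by have := hν.1; positivity
    exact mul_pos (by positivity) (mul_pos hνc hloΛ)
  have hq0 : 0 < q := by
    rw [hq, ← norm_latticeVec_sq_eq]
    have hL0 : 0 < ‖Torus.latticeVec ℓ‖ := by
      refine norm_pos_iff.2 fun h => hℓ0 ?_
      funext i
      have hi := congrArg (fun w : EuclideanSpace ℝ (Fin 3) => w i) h
      simpa [Torus.latticeVec_apply] using hi
    positivity
  have hR0 : 0 < R := by rw [hR]; positivity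
  have hu0 : 0 < u := mul_pos hR0 hP0
  have huY : u ≤ Y := by rw [hu, hY]; exact mul_le_mul_of_nonneg_left hPτ.le hR0.le
  have hY2 : Y ≤ 2 := hRτ
  -- raw sideband
  set S : ℝ := ∑ j, ‖slotAmp W j‖ with hS
  have hS0 : 0 ≤ S := Finset.sum_nonneg fun j _ => norm_nonneg _
  set cSp : ℝ := 8 * S / (Real.pi * (lo / Λ) * Real.sqrt (8 * Real.pi ^ 2 * (lo / Λ) * (M * W.period) * c)) with hcSp
  have hcSp0 : 0 ≤ cSp := by rw [hcSp]; positivity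
  have hraw := sideband_le_cS hlo hhi hΛ hν hn hwin hU j₀ hs₀ hst.le htT hsT hLb hℓ0 hℓL w hw hws
  have hcS := cS_le_cSp_sqrt (W := W) hlo hΛ hc hM hν.1 hn S hS0 ℓ
  have h1 : Real.sqrt (‖U s t w‖ ^ 2 - (‖fc (U s t w) ℓ‖ ^ 2 + ‖fc (U s t w) (-ℓ)‖ ^ 2)) ≤ cSp * Real.sqrt u * ‖w‖ :=
    hraw.trans (mul_le_mul_of_nonneg_right hcS (norm_nonneg _))
  -- the allowance
  set y : ℝ := P / (t - s) with hy
  have hy0 : 0 < y := div_pos hP0 hτ0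
  have hy1 : y ≤ 1 := (div_le_one hτ0).2 hPτ.le
  have hmin : min 1 (P / (t - s)) = y := by rw [hy]; exact min_eq_right hy1
  have hyuY : y = u / Y := by rw [hy, hu, hY]; field_simp
  set X : ℝ := ν ^ e + ((⌈K / ν⌉₊ : ℝ) / n) ^ e with hX
  have hX0 : 0 ≤ X := by
    have h1 : 0 ≤ ν ^ e := Real.rpow_nonneg hν.1.le _
    have h2 : 0 ≤ ((⌈K / ν⌉₊ : ℝ) / n) ^ e := Real.rpow_nonneg (by positivity) _
    rw [hX]; linarith
  have hye0 : 0 ≤ y ^ e := Real.rpow_nonneg hy0.le _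
  have halw : C₁ * y ^ e ≤ C₁ * (C₁ * X + y ^ e) := by nlinarith [mul_nonneg hC₁0 (mul_nonneg hC₁0 hX0)]
  -- `√dW ≥ √(½ min 1 Y)`
  have hdW : 1 / 2 * min 1 Y ≤ dW lo Λ c ν n (t - s) ℓ := by
    unfold dW; rw [show 8 * Real.pi ^ 2 * loT lo Λ c ν n * Torus.freqNormSq ℓ * (t - s) = Y by rw [hY, hR, hq]]
    exact one_sub_exp_neg_ge (by positivity)
  have hsdW : Real.sqrt (1 / 2 * min 1 Y) ≤ Real.sqrt (dW lo Λ c ν n (t - s) ℓ) := Real.sqrt_le_sqrt hdW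
  -- the charge
  have hch := sqrt_le_two_mul_rpow_mul_sqrt hu0 huY hY2 he12
  rw [← hyuY] at hch
  have h2 : cSp * Real.sqrt u ≤ (C₁ * (C₁ * X + y ^ e)) * Real.sqrt (dW lo Λ c ν n (t - s) ℓ) := by
    calc cSp * Real.sqrt u ≤ cSp * (2 * y ^ e * Real.sqrt (1 / 2 * min 1 Y)) := mul_le_mul_of_nonneg_left hch hcSp0
      _ = (2 * cSp) * y ^ e * Real.sqrt (1 / 2 * min 1 Y) := by ring
      _ ≤ C₁ * y ^ e * Real.sqrt (dW lo Λ c ν n (t - s) ℓ) :=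
          mul_le_mul (mul_le_mul_of_nonneg_right hC₁ hye0) hsdW (Real.sqrt_nonneg _) (by positivity)
      _ ≤ (C₁ * (C₁ * X + y ^ e)) * Real.sqrt (dW lo Λ c ν n (t - s) ℓ) := mul_le_mul_of_nonneg_right halw (Real.sqrt_nonneg _)
  rw [hmin]
  calc Real.sqrt (‖U s t w‖ ^ 2 - (‖fc (U s t w) ℓ‖ ^ 2 + ‖fc (U s t w) (-ℓ)‖ ^ 2)) ≤ cSp * Real.sqrt u * ‖w‖ := h1
    _ ≤ (C₁ * (C₁ * X + y ^ e)) * Real.sqrt (dW lo Λ c ν n (t - s) ℓ) * ‖w‖ := mul_le_mul_of_nonneg_right h2 (norm_nonneg _)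
    _ = _ := by rw [hX]

set_option maxHeartbeats 1600000 in
/-- **THE ν-FLOOR ROW OF (sf) ON COARSE LABELS** (grid phase, `P < τ`, within scale `u ≤ 1`, `ν_c ≤ ν`, `0 ≤ e ≤ 1/2`, `C₁²ν_c^e ≥ 2cSp`; no
smallness of the one-step constants): the same conclusion, paid by the floor `C₁²ν^e`. -/
theorem sideband_le_alw_of_nufloor (hlo : 0 < lo) (hhi : 0 ≤ hi) (hΛ : 1 ≤ Λ) (hc : 0 < c)
    (hν : ν ∈ Set.Ioo 0 ν₀) (hn : 1 ≤ n) (hwin : ∃ lam ∈ Set.Icc (1:ℝ) Λ, NearIso 𝔸 (ν * (lo / lam)) (ν * (hi * lam)))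
    (hU : IsPropagator Tw (cellField W M hM ν hν.1 n) ((1 / (n:ℝ) ^ 2) • 𝔸) U)
    {s t : ℝ} (j₀ : ℕ) (hs₀ : s = j₀ * (M * W.period / ν)) (htT : t ≤ Tw)
    {Lb : ℕ} (hLb : 2 * Lb < n) {ℓ : Fin 3 → ℤ} (hℓ0 : ℓ ≠ 0) (hℓL : ℓ ∈ Torus.freqBall (d := Fin 3) Lb)
    (w : V2) (hw : w ∈ divFreeL2 (Fin 3)) (hws : ∀ k', k' ≠ ℓ → k' ≠ -ℓ → fc w k' = 0)
    {C₁ e νc : ℝ} (hC₁0 : 0 ≤ C₁) (hνc0 : 0 < νc) (hνc : νc ≤ ν)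
    (hC₁ : 2 * (8 * (∑ j, ‖slotAmp W j‖) / (Real.pi * (lo / Λ) * Real.sqrt (8 * Real.pi ^ 2 * (lo / Λ) * (M * W.period) * c)))
      ≤ C₁ * C₁ * νc ^ e)
    (he0 : 0 ≤ e)
    (hPτ : M * W.period / ν < t - s)
    (hRP : 8 * Real.pi ^ 2 * loT lo Λ c ν n * Torus.freqNormSq ℓ * (M * W.period / ν) ≤ 1) :
    Real.sqrt (‖U s t w‖ ^ 2 - (‖fc (U s t w) ℓ‖ ^ 2 + ‖fc (U s t w) (-ℓ)‖ ^ 2))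
      ≤ (C₁ * (C₁ * (ν ^ e + ((⌈K / ν⌉₊ : ℝ) / n) ^ e) + (min 1 ((M * W.period / ν) / (t - s))) ^ e))
        * Real.sqrt (dW lo Λ c ν n (t - s) ℓ) * ‖w‖ := by
  have hWp := PermissibleCarrier.period_pos W
  have hMW : 0 < M * W.period := mul_pos hM hWp
  have hn0 : (0:ℝ) < n := by exact_mod_cast (show 0 < n from hn)
  have hΛ0 : 0 < Λ := lt_of_lt_of_le one_pos hΛ
  have hloΛ : 0 < lo / Λ := div_pos hlo hΛ0
  set P : ℝ := M * W.period / ν with hP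
  have hP0 : 0 < P := div_pos hMW hν.1
  have hst : s < t := by linarith
  have hτ0 : 0 < t - s := by linarith
  have hsT : s < Tw := lt_of_lt_of_le hst htT
  set q : ℝ := Torus.freqNormSq ℓ with hq
  set R : ℝ := 8 * Real.pi ^ 2 * loT lo Λ c ν n * q with hR
  set u : ℝ := R * P with hu
  set Y : ℝ := R * (t - s) with hY
  have hloT : 0 < loT lo Λ c ν n := by
    unfold loT; have hνc' : 0 < ν + c / ν := by have := hν.1; positivity
    exact mul_pos (by positivity) (mul_pos hνc' hloΛ)
  have hq0 : 0 < q := by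
    rw [hq, ← norm_latticeVec_sq_eq]
    have hL0 : 0 < ‖Torus.latticeVec ℓ‖ := by
      refine norm_pos_iff.2 fun h => hℓ0 ?_
      funext i
      have hi := congrArg (fun w : EuclideanSpace ℝ (Fin 3) => w i) h
      simpa [Torus.latticeVec_apply] using hi
    positivity
  have hR0 : 0 < R := by rw [hR]; positivity
  have hu0 : 0 < u := mul_pos hR0 hP0
  have hu1 : u ≤ 1 := hRP
  have huY : u ≤ Y := by rw [hu, hY]; exact mul_le_mul_of_nonneg_left hPτ.le hR0.le
  -- raw sideband
  set S : ℝ := ∑ j, ‖slotAmp W j‖ with hS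
  have hS0 : 0 ≤ S := Finset.sum_nonneg fun j _ => norm_nonneg _
  set cSp : ℝ := 8 * S / (Real.pi * (lo / Λ) * Real.sqrt (8 * Real.pi ^ 2 * (lo / Λ) * (M * W.period) * c)) with hcSp
  have hcSp0 : 0 ≤ cSp := by rw [hcSp]; positivity
  have hraw := sideband_le_cS hlo hhi hΛ hν hn hwin hU j₀ hs₀ hst.le htT hsT hLb hℓ0 hℓL w hw hws
  have hcS := cS_le_cSp_sqrt (W := W) hlo hΛ hc hM hν.1 hn S hS0 ℓ
  have h1 : Real.sqrt (‖U s t w‖ ^ 2 - (‖fc (U s t w) ℓ‖ ^ 2 + ‖fc (U s t w) (-ℓ)‖ ^ 2)) ≤ cSp * Real.sqrt u * ‖w‖ :=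
    hraw.trans (mul_le_mul_of_nonneg_right hcS (norm_nonneg _))
  -- the allowance: the floor `C₁²ν^e ≥ C₁²νc^e ≥ 2cSp` and `√dW ≥ √(u/2)`
  set y : ℝ := P / (t - s) with hy
  have hy0 : 0 < y := div_pos hP0 hτ0
  have hy1 : y ≤ 1 := (div_le_one hτ0).2 hPτ.le
  have hmin : min 1 (P / (t - s)) = y := by rw [hy]; exact min_eq_right hy1
  have hνe : νc ^ e ≤ ν ^ e := Real.rpow_le_rpow hνc0.le hνc he0
  have hue0 : 0 ≤ ((⌈K / ν⌉₊ : ℝ) / n) ^ e := Real.rpow_nonneg (by positivity) _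
  have hye0 : 0 ≤ y ^ e := Real.rpow_nonneg hy0.le _
  have halw : C₁ * C₁ * νc ^ e ≤ C₁ * (C₁ * (ν ^ e + ((⌈K / ν⌉₊ : ℝ) / n) ^ e) + y ^ e) := by
    nlinarith [mul_nonneg (mul_nonneg hC₁0 hC₁0) (sub_nonneg.2 hνe), mul_nonneg (mul_nonneg hC₁0 hC₁0) hue0, mul_nonneg hC₁0 hye0]
  have hdW : 1 / 2 * min 1 Y ≤ dW lo Λ c ν n (t - s) ℓ := by
    unfold dW; rw [show 8 * Real.pi ^ 2 * loT lo Λ c ν n * Torus.freqNormSq ℓ * (t - s) = Y by rw [hY, hR, hq]]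
    exact one_sub_exp_neg_ge (by positivity)
  have hu2 : u / 2 ≤ 1 / 2 * min 1 Y := by
    have : u ≤ min 1 Y := le_min hu1 huY
    linarith
  have hsdW : Real.sqrt (u / 2) ≤ Real.sqrt (dW lo Λ c ν n (t - s) ℓ) := Real.sqrt_le_sqrt (hu2.trans hdW)
  have hsu : Real.sqrt u ≤ 2 * Real.sqrt (u / 2) := by
    rw [show (2:ℝ) = Real.sqrt 4 by rw [show (4:ℝ) = 2 ^ 2 by norm_num, Real.sqrt_sq (by norm_num)], ← Real.sqrt_mul (by norm_num)]
    exact Real.sqrt_le_sqrt (by linarith)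
  have h2 : cSp * Real.sqrt u ≤ (C₁ * (C₁ * (ν ^ e + ((⌈K / ν⌉₊ : ℝ) / n) ^ e) + y ^ e)) * Real.sqrt (dW lo Λ c ν n (t - s) ℓ) := by
    calc cSp * Real.sqrt u ≤ cSp * (2 * Real.sqrt (u / 2)) := mul_le_mul_of_nonneg_left hsu hcSp0
      _ = (2 * cSp) * Real.sqrt (u / 2) := by ring
      _ ≤ (C₁ * C₁ * νc ^ e) * Real.sqrt (dW lo Λ c ν n (t - s) ℓ) := mul_le_mul hC₁ hsdW (Real.sqrt_nonneg _) (by positivity)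
      _ ≤ _ := mul_le_mul_of_nonneg_right halw (Real.sqrt_nonneg _)
  rw [hmin]
  calc Real.sqrt (‖U s t w‖ ^ 2 - (‖fc (U s t w) ℓ‖ ^ 2 + ‖fc (U s t w) (-ℓ)‖ ^ 2)) ≤ cSp * Real.sqrt u * ‖w‖ := h1
    _ ≤ _ := mul_le_mul_of_nonneg_right h2 (norm_nonneg _)

end Clause

end Summit.AnomalousDissipation.AnomalousDissipation.Theorems.SolenoidalFractalHomogenisation.LagrangianStep.VmodGen

end
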